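import Mathlib
import Literature.AlgebraicGeometry.Resolution.TeissierPresentation
import Literature.AlgebraicGeometry.Resolution.AdicNoetherian
import HarnessLib

/-!
# `TeissierResolve`, line `Sketch`: the pure algebra behind the finiteness of Teissier branches

Route `ResolutionOfSingularities/TeissierJung`, crux `TeissierResolve`
(stmt-ResolutionOfSingularities-17086), lemmas for the stub `stub_branchFinite` of the lead's
skeleton (the stub itself is assembled in `TeissierJungTeissierResolveBranchFinite.lean`).

**Content.** Let `K` be a field, `R = K⟦x₁, …, x_d⟧`, and let `(n, v, c, A, μ, h)` be a Teissier
datum with `g` steps (`Teissier.IsDatum`, file `Literature/…/TeissierPresentation.lean`), with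
ideal of equations `I = (E₀, …, E_{g-1}) ⊂ R[u₀, …, u_{g-1}]` (`Teissier.ideal`).

* `ideal_sup_map_maximalIdeal_ne_top` — for `K` algebraically closed, `I + (x₁, …, x_d)` is a
  PROPER ideal of `R[u]`: the equations and the `x_j` have the common zero `u = (γ, 0, …, 0)`,
  where `γ^{n₀} = c₀` if `A₀ = 0` and `γ = 0` otherwise. (Bookkeeping from `IsDatum`: a monomial
  of `h_i`, or the monomial `(z,u)^{μ_i}` when `A_i = 0`, that survives the substitution would have
  weight `0`, contradicting overweight / homogeneity and `0 ≤ n_i v_i`, `v_i ≠ 0` for `i ≥ 1`.)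
* `TeissierPresentation.map_maximalIdeal_ne_top`, `.nontrivial`, `.isNoetherianRing`,
  `.residue_comp_surjective` — consequences for a ring `B` carrying a Teissier presentation with
  structure map `ι : R → B`: `ι((x)) B ≠ B`; `B ≠ 0`; `B` is Noetherian; and if `B` is local then
  `R → B → B/𝔪_B` is onto (the residue field is a field finitely generated over the algebraically
  closed field `K` through `K[u] → R[u]/I ≅ B → B/𝔪_B`, hence equal to `K` by the Nullstellensatz).

Sources: H. Mourtada, B. Schober, *Teissier singularities* (2025), §3 (the shape of the
equations); Matsumura, *Commutative Ring Theory*, proof of Thm. 29.4 (iii) (the consumer: residue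
field and `𝔪`-primary structure ideal feed Thm. 8.4). Everything here is [folklore]; no
definitions, no named facts.
-/

noncomputable section

set_option linter.dupNamespace false -- mandated namespace of this single-conjunct summit

open IsLocalRing
open Literature.AlgebraicGeometry.Resolution

namespace Summit.ResolutionOfSingularities.ResolutionOfSingularities.Theorems.TeissierResolve.BranchFiniteLemmas

universe u v

/-! ## Weights -/

section Weights

variable {d g : ℕ}

/-- A monomial `(z,u)^e` involving only `u₀ = z`, and with `e₀ = 0` or `v₀ = 0`, has weight `0`.
[folklore] -/
theorem weight_zero_eq_zero (v : Fin (g + 1) → Fin d → ℚ) (e : Fin (g + 1) →₀ ℕ)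
    (h1 : ∀ j, j ≠ 0 → e j = 0) (h2 : e 0 = 0 ∨ v 0 = 0) : Teissier.weight v 0 e = 0 := by
  funext l
  rw [Teissier.weight_apply]
  simp only [Finsupp.coe_zero, Pi.zero_apply, Nat.cast_zero, zero_add]
  refine Finset.sum_eq_zero fun i _ => ?_
  by_cases hi : i = 0
  · subst hi
    rcases h2 with h | h
    · simp [h]
    · simp [h]
  · simp [h1 i hi]

/-- A nonnegative vector `w` with `m • w ≤ 0` has `m • w = 0`. [folklore] -/
theorem nsmul_eq_zero_of_le_zero {m : ℕ} {w : Fin d → ℚ} (hw : ∀ l, 0 ≤ w l) (hle : m • w ≤ 0) :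
    m • w = 0 := by
  funext l
  refine le_antisymm (hle l) ?_
  simp only [Pi.zero_apply, Pi.smul_apply, nsmul_eq_mul]
  exact mul_nonneg (Nat.cast_nonneg m) (hw l)

/-- If `m • w = 0` with `m ≥ 2` then `w = 0`. [folklore] -/
theorem eq_zero_of_nsmul_eq_zero {m : ℕ} (hm : 2 ≤ m) {w : Fin d → ℚ} (h : m • w = 0) : w = 0 := by
  funext l
  have := congrFun h l
  simp only [Pi.smul_apply, nsmul_eq_mul, Pi.zero_apply, mul_eq_zero, Nat.cast_eq_zero] at this
  exact this.resolve_left (by omega)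

end Weights

/-! ## Consequences of `IsDatum` -/

section Datum

variable {K : Type u} [Field K] {d g : ℕ}
  {n : Fin (g + 1) → ℕ} {v : Fin (g + 1) → Fin d → ℚ} {c : Fin (g + 1) → K}
  {A : Fin (g + 1) → Fin d →₀ ℕ} {mu : Fin (g + 1) → Fin (g + 1) →₀ ℕ}
  {h : Fin (g + 1) → MvPolynomial (Fin (g + 1)) (MvPowerSeries (Fin d) K)}

/-- `μ₀ = 0`: the first binomial is `z^{n₀} − c₀ x^{A₀}`. [folklore] -/
theorem mu_zero (hd : Teissier.IsDatum n v c A mu h) : mu 0 = 0 := by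
  ext j
  exact hd.mu_eq_zero 0 j (Nat.zero_le _)

/-- No weight can be both `≥ n_i v_i`, `≠ n_i v_i` and equal to `0` (since `n_i v_i ≥ 0`).
[folklore] -/
theorem false_of_overweight_zero (hd : Teissier.IsDatum n v c A mu h) (i : Fin (g + 1))
    {w : Fin d → ℚ} (hw : w = 0) (how : n i • v i ≤ w ∧ n i • v i ≠ w) : False := by
  subst hw
  exact how.2 (nsmul_eq_zero_of_le_zero (hd.weight_nonneg i) how.1)

/-- If `A₀ = 0` then `v₀ = 0` (homogeneity of the first binomial). [folklore] -/
theorem v_zero (hd : Teissier.IsDatum n v c A mu h) (hA : A 0 = 0) : v 0 = 0 := by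
  have hhom := hd.homogeneous 0
  rw [hA, mu_zero hd, weight_zero_eq_zero v 0 (fun _ _ => rfl) (Or.inl rfl)] at hhom
  exact eq_zero_of_nsmul_eq_zero (hd.two_le 0) hhom

/-- `v_i ≠ 0` for `i ≥ 1` (since `0 ≤ n_{i-1} v_{i-1} < v_i`). [folklore] -/
theorem v_ne_zero (hd : Teissier.IsDatum n v c A mu h) {i : Fin (g + 1)} (hi : i ≠ 0) :
    v i ≠ 0 := by
  intro hv
  have hi' : (i : ℕ) ≠ 0 := by
    contrapose! hi
    exact Fin.ext hi
  have hlt : (i : ℕ) - 1 + 1 < g + 1 := by have := i.isLt; omega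
  have key := hd.weight_lt ⟨(i : ℕ) - 1, by omega⟩ hlt
  have heq : (⟨(i : ℕ) - 1 + 1, hlt⟩ : Fin (g + 1)) = i := Fin.ext (by simp; omega)
  rw [heq, hv] at key
  exact key.2 (nsmul_eq_zero_of_le_zero (hd.weight_nonneg _) key.1)

/-- A monomial `(z,u)^e` whose weight is not `0` dies under the substitution
`u ↦ (γ, 0, …, 0)`, provided `γ = 0` unless `A₀ = 0`. [folklore] -/
theorem prod_single_pow_eq_zero (hd : Teissier.IsDatum n v c A mu h) {γ : K}
    (hγ : A 0 ≠ 0 → γ = 0) (e : Fin (g + 1) →₀ ℕ) (he : Teissier.weight v 0 e ≠ 0) :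
    (e.prod fun j k => (Pi.single 0 γ : Fin (g + 1) → K) j ^ k) = 0 := by
  by_contra hne
  apply he
  apply weight_zero_eq_zero
  · intro j hj
    by_contra hej
    apply hne
    simp only [Finsupp.prod]
    exact Finset.prod_eq_zero (Finsupp.mem_support_iff.mpr hej)
      (by rw [Pi.single_eq_of_ne hj, zero_pow hej])
  · by_cases he0 : e 0 = 0
    · exact Or.inl he0
    · right
      apply v_zero hd
      by_contra hA
      apply hne
      simp only [Finsupp.prod]
      exact Finset.prod_eq_zero (Finsupp.mem_support_iff.mpr he0)
        (by rw [Pi.single_eq_same, hγ hA, zero_pow he0])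

/-- The overweight tails `h_i` die under `R[u] → K`, `u ↦ (γ, 0, …, 0)`, constant coefficient on
`R = K⟦x⟧` (with `γ = 0` unless `A₀ = 0`). [folklore] -/
theorem eval₂_h (hd : Teissier.IsDatum n v c A mu h) {γ : K} (hγ : A 0 ≠ 0 → γ = 0)
    (i : Fin (g + 1)) :
    MvPolynomial.eval₂Hom MvPowerSeries.constantCoeff (Pi.single 0 γ) (h i) = 0 := by
  rw [MvPolynomial.coe_eval₂Hom, MvPolynomial.eval₂_eq]
  refine Finset.sum_eq_zero fun e he => ?_
  by_cases hc : MvPowerSeries.constantCoeff ((h i).coeff e) = 0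
  · rw [hc, zero_mul]
  · have hw := ((hd.overweight i e he).2 0
      (by rwa [MvPowerSeries.coeff_zero_eq_constantCoeff_apply]))
    have hne : Teissier.weight v 0 e ≠ 0 := fun h0 => false_of_overweight_zero hd i h0 hw
    have := prod_single_pow_eq_zero hd hγ e hne
    simp only [Finsupp.prod] at this
    rw [this, mul_zero]

/-- The core polynomials `u_i^{n_i} − c_i x^{A_i} (z,u)^{μ_i} + h_i` die under `u ↦ (γ, 0, …, 0)`
when `γ^{n₀} = c₀` if `A₀ = 0` and `γ = 0` otherwise. [folklore] -/
theorem eval₂_core (hd : Teissier.IsDatum n v c A mu h) {γ : K} (hγ0 : A 0 = 0 → γ ^ n 0 = c 0)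
    (hγ : A 0 ≠ 0 → γ = 0) (i : Fin (g + 1)) :
    MvPolynomial.eval₂Hom MvPowerSeries.constantCoeff (Pi.single 0 γ)
      (Teissier.core n c A mu h i) = 0 := by
  have h2 := hd.two_le i
  rw [Teissier.core, map_add, map_sub, map_mul, map_pow, eval₂_h hd hγ i, add_zero,
    MvPolynomial.eval₂Hom_X', MvPolynomial.eval₂Hom_C, MvPolynomial.eval₂Hom_monomial, map_one,
    one_mul]
  by_cases hi : i = 0
  · subst hi
    rw [mu_zero hd, Finsupp.prod_zero_index, mul_one, Pi.single_eq_same]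
    by_cases hA : A 0 = 0
    · rw [hγ0 hA, hA, ← MvPowerSeries.coeff_zero_eq_constantCoeff_apply,
        MvPowerSeries.coeff_monomial_same, sub_self]
    · rw [hγ hA, zero_pow (by omega), ← MvPowerSeries.coeff_zero_eq_constantCoeff_apply,
        MvPowerSeries.coeff_monomial_ne (Ne.symm hA), sub_zero]
  · rw [Pi.single_eq_of_ne hi, zero_pow (by omega), zero_sub, neg_eq_zero]
    by_cases hA : A i = 0
    · rw [hA, ← MvPowerSeries.coeff_zero_eq_constantCoeff_apply, MvPowerSeries.coeff_monomial_same,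
        prod_single_pow_eq_zero hd hγ (mu i) ?_, mul_zero]
      intro h0
      have hhom := hd.homogeneous i
      rw [hA, h0] at hhom
      exact v_ne_zero hd hi (eq_zero_of_nsmul_eq_zero h2 hhom)
    · rw [← MvPowerSeries.coeff_zero_eq_constantCoeff_apply,
        MvPowerSeries.coeff_monomial_ne (Ne.symm hA), zero_mul]

/-- The defining equations `E_i` die under `u ↦ (γ, 0, …, 0)` (same `γ`). [folklore] -/
theorem eval₂_equation (hd : Teissier.IsDatum n v c A mu h) {γ : K}
    (hγ0 : A 0 = 0 → γ ^ n 0 = c 0) (hγ : A 0 ≠ 0 → γ = 0) (i : Fin (g + 1)) :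
    MvPolynomial.eval₂Hom MvPowerSeries.constantCoeff (Pi.single 0 γ)
      (Teissier.equation n c A mu h i) = 0 := by
  rw [Teissier.equation]
  split_ifs with hi
  · rw [map_sub, eval₂_core hd hγ0 hγ i, sub_zero, MvPolynomial.eval₂Hom_X',
      Pi.single_eq_of_ne (ne_of_apply_ne Fin.val (Nat.succ_ne_zero _))]
  · exact eval₂_core hd hγ0 hγ i

/-- Over an algebraically closed field the first coordinate `γ` of the common zero exists:
`γ^{n₀} = c₀` if `A₀ = 0`, `γ = 0` otherwise. [folklore] -/
theorem exists_gamma [IsAlgClosed K] (hd : Teissier.IsDatum n v c A mu h) :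
    ∃ γ : K, (A 0 = 0 → γ ^ n 0 = c 0) ∧ (A 0 ≠ 0 → γ = 0) := by
  by_cases hA : A 0 = 0
  · obtain ⟨γ, hγ⟩ := IsAlgClosed.exists_pow_nat_eq (c 0) (n := n 0)
      (by have := hd.two_le 0; omega)
    exact ⟨γ, fun _ => hγ, fun h' => (h' hA).elim⟩
  · exact ⟨0, fun h' => (hA h').elim, fun _ => rfl⟩

end Datum

/-! ## The ideal `I + (x)` is proper -/

section Proper

variable {K : Type u} [Field K] {d : ℕ}

/-- In `K⟦x⟧` the maximal ideal is the kernel of the constant coefficient. [folklore] -/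
theorem mem_maximalIdeal_iff_constantCoeff {σ : Type*} (a : MvPowerSeries σ K) :
    a ∈ maximalIdeal (MvPowerSeries σ K) ↔ MvPowerSeries.constantCoeff a = 0 := by
  rw [IsLocalRing.mem_maximalIdeal, mem_nonunits_iff, MvPowerSeries.isUnit_iff_constantCoeff,
    isUnit_iff_ne_zero, not_not]

variable [IsAlgClosed K]

/-- For a Teissier datum over an algebraically closed field there is a ring homomorphism
`R[u] → K` killing the equations and the variables `x_j` (evaluation at the common zero
`(γ, 0, …, 0)`, constant coefficient on `R = K⟦x⟧`). [folklore] -/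
theorem exists_ideal_sup_map_le_ker {g : ℕ} {n : Fin g → ℕ} {v : Fin g → Fin d → ℚ}
    {c : Fin g → K} {A : Fin g → Fin d →₀ ℕ} {mu : Fin g → Fin g →₀ ℕ}
    {h : Fin g → MvPolynomial (Fin g) (MvPowerSeries (Fin d) K)}
    (hd : Teissier.IsDatum n v c A mu h) :
    ∃ χ : MvPolynomial (Fin g) (MvPowerSeries (Fin d) K) →+* K,
      Teissier.ideal n c A mu h ⊔ (maximalIdeal (MvPowerSeries (Fin d) K)).map MvPolynomial.C ≤
        RingHom.ker χ := by
  have hC : ∀ (p : Fin g → K), (maximalIdeal (MvPowerSeries (Fin d) K)).map MvPolynomial.C ≤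
      RingHom.ker (MvPolynomial.eval₂Hom MvPowerSeries.constantCoeff p) := by
    intro p
    rw [Ideal.map_le_iff_le_comap]
    intro a ha
    rw [Ideal.mem_comap, RingHom.mem_ker, MvPolynomial.eval₂Hom_C]
    exact (mem_maximalIdeal_iff_constantCoeff a).mp ha
  cases g with
  | zero =>
    refine ⟨MvPolynomial.eval₂Hom MvPowerSeries.constantCoeff 0, sup_le ?_ (hC 0)⟩
    rw [Teissier.ideal, Ideal.span_le]
    rintro _ ⟨i, rfl⟩
    exact i.elim0
  | succ g =>
    obtain ⟨γ, hγ0, hγ⟩ := exists_gamma hd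
    refine ⟨MvPolynomial.eval₂Hom MvPowerSeries.constantCoeff (Pi.single 0 γ),
      sup_le ?_ (hC _)⟩
    rw [Teissier.ideal, Ideal.span_le]
    rintro _ ⟨i, rfl⟩
    exact (RingHom.mem_ker).mpr (eval₂_equation hd hγ0 hγ i)

/-- **`I + (x₁, …, x_d) ≠ R[u]`** for the ideal `I` of a Teissier datum over an algebraically
closed field `K` (`R = K⟦x⟧`). [folklore] -/
theorem ideal_sup_map_maximalIdeal_ne_top {g : ℕ} {n : Fin g → ℕ} {v : Fin g → Fin d → ℚ}
    {c : Fin g → K} {A : Fin g → Fin d →₀ ℕ} {mu : Fin g → Fin g →₀ ℕ}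
    {h : Fin g → MvPolynomial (Fin g) (MvPowerSeries (Fin d) K)}
    (hd : Teissier.IsDatum n v c A mu h) :
    Teissier.ideal n c A mu h ⊔ (maximalIdeal (MvPowerSeries (Fin d) K)).map MvPolynomial.C ≠
      ⊤ := by
  obtain ⟨χ, hχ⟩ := exists_ideal_sup_map_le_ker hd
  intro htop
  rw [htop, top_le_iff] at hχ
  exact RingHom.ker_ne_top χ hχ

end Proper

/-! ## Consequences for a Teissier-presented ring -/

section Presentation

variable {K : Type u} [Field K] {d : ℕ} {B : Type v} [CommRing B]
  {ι : MvPowerSeries (Fin d) K →+* B}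

/-- A Teissier-presented ring is Noetherian (`K⟦x⟧[u]/I`). [folklore] -/
theorem TeissierPresentation.isNoetherianRing (hB : TeissierPresentation K d B ι) :
    IsNoetherianRing B := by
  obtain ⟨g, n, v, c, A, mu, h, -, ψ, -⟩ := hB
  haveI : IsNoetherianRing (MvPowerSeries (Fin d) K) := isNoetherianRing_mvPowerSeries K (Fin d)
  exact isNoetherianRing_of_ringEquiv _ ψ.symm

variable [IsAlgClosed K]

/-- **The ideal `ι((x)) B` of a Teissier-presented ring `B` is proper** (over an algebraically
closed field). [folklore] -/
theorem TeissierPresentation.map_maximalIdeal_ne_top (hB : TeissierPresentation K d B ι) :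
    (maximalIdeal (MvPowerSeries (Fin d) K)).map ι ≠ ⊤ := by
  obtain ⟨g, n, v, c, A, mu, h, hd, ψ, hψ⟩ := hB
  obtain ⟨χ, hχ⟩ := exists_ideal_sup_map_le_ker hd
  have hI : ∀ a ∈ Teissier.ideal n c A mu h, χ a = 0 := fun a ha => hχ (Ideal.mem_sup_left ha)
  intro htop
  let θ : B →+* K := (Ideal.Quotient.lift _ χ hI).comp ψ.toRingHom
  have hle : (maximalIdeal (MvPowerSeries (Fin d) K)).map ι ≤ RingHom.ker θ := by
    rw [Ideal.map_le_iff_le_comap]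
    intro a ha
    rw [Ideal.mem_comap, RingHom.mem_ker]
    show Ideal.Quotient.lift _ χ hI (ψ (ι a)) = 0
    rw [hψ a, Ideal.Quotient.lift_mk]
    exact hχ (Ideal.mem_sup_right (Ideal.mem_map_of_mem _ ha))
  rw [htop, top_le_iff] at hle
  exact RingHom.ker_ne_top θ hle

/-- A Teissier-presented ring over an algebraically closed field is nonzero. [folklore] -/
theorem TeissierPresentation.nontrivial (hB : TeissierPresentation K d B ι) : Nontrivial B := by
  by_contra htriv
  rw [not_nontrivial_iff_subsingleton] at htriv
  exact TeissierPresentation.map_maximalIdeal_ne_top hB ((Ideal.eq_top_iff_one _).mpr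
    (by rw [Subsingleton.elim (1 : B) 0]; exact Ideal.zero_mem _))

/-- **The residue field of a local Teissier-presented ring is `K`**: for `B` local carrying a
Teissier presentation with structure map `ι : K⟦x⟧ → B` over an algebraically closed field `K`,
the composite `K⟦x⟧ → B → B/𝔪_B` is onto. Indeed `𝔪_B ⊇ ι((x))`, so `B/𝔪_B` is a field
generated over `K` by the classes of `u₀, …, u_{g-1}`, hence equal to `K` (Nullstellensatz).
[folklore] -/
theorem TeissierPresentation.residue_comp_surjective [IsLocalRing B]
    (hB : TeissierPresentation K d B ι) :
    Function.Surjective ((IsLocalRing.residue B).comp ι) := by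
  have hloc : (maximalIdeal (MvPowerSeries (Fin d) K)).map ι ≤ maximalIdeal B :=
    IsLocalRing.le_maximalIdeal (TeissierPresentation.map_maximalIdeal_ne_top hB)
  obtain ⟨g, n, v, c, A, mu, h, -, ψ, hψ⟩ := hB
  -- `θ : R[u] → R[u]/I ≅ B → B/𝔪_B`
  let θ : MvPolynomial (Fin g) (MvPowerSeries (Fin d) K) →+* ResidueField B :=
    (residue B).comp (ψ.symm.toRingHom.comp (Ideal.Quotient.mk (Teissier.ideal n c A mu h)))
  have hθC : ∀ a, θ (MvPolynomial.C a) = residue B (ι a) := by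
    intro a
    show residue B (ψ.symm (Ideal.Quotient.mk _ (MvPolynomial.C a))) = _
    rw [← hψ a, RingEquiv.symm_apply_apply]
  have hθ : Function.Surjective θ :=
    residue_surjective.comp (ψ.symm.surjective.comp Ideal.Quotient.mk_surjective)
  -- `θK : K[u] → B/𝔪_B`, through which `θ` factors (coefficients reduced mod `(x)`)
  let θK : MvPolynomial (Fin g) K →+* ResidueField B :=
    θ.comp (MvPolynomial.map (MvPowerSeries.C : K →+* MvPowerSeries (Fin d) K))
  have hθK_C : ∀ r : K, θK (MvPolynomial.C r) = residue B (ι (MvPowerSeries.C r)) := by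
    intro r
    show θ (MvPolynomial.map _ (MvPolynomial.C r)) = _
    rw [MvPolynomial.map_C, hθC]
  have hfac : θ = θK.comp (MvPolynomial.map
      (MvPowerSeries.constantCoeff : MvPowerSeries (Fin d) K →+* K)) := by
    refine MvPolynomial.ringHom_ext (fun a => ?_) (fun i => ?_)
    · show θ (MvPolynomial.C a) =
        θK (MvPolynomial.map MvPowerSeries.constantCoeff (MvPolynomial.C a))
      rw [MvPolynomial.map_C, hθK_C, hθC, ← sub_eq_zero, ← map_sub, ← map_sub,
        IsLocalRing.residue_eq_zero_iff]
      refine hloc (Ideal.mem_map_of_mem ι ((mem_maximalIdeal_iff_constantCoeff _).mpr ?_))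
      rw [map_sub, MvPowerSeries.constantCoeff_C, sub_self]
    · show θ (MvPolynomial.X i) =
        θK (MvPolynomial.map MvPowerSeries.constantCoeff (MvPolynomial.X i))
      rw [MvPolynomial.map_X]
      show _ = θ (MvPolynomial.map _ (MvPolynomial.X i))
      rw [MvPolynomial.map_X]
  have hθK : Function.Surjective θK := by
    intro t
    obtain ⟨F, rfl⟩ := hθ t
    exact ⟨MvPolynomial.map MvPowerSeries.constantCoeff F, by rw [hfac]; rfl⟩
  -- the kernel of `θK` is a `K`-point (Nullstellensatz)
  haveI : (RingHom.ker θK).IsMaximal := RingHom.ker_isMaximal_of_surjective θK hθK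
  obtain ⟨z, hz⟩ :=
    (MvPolynomial.isMaximal_iff_eq_vanishingIdeal_singleton (K := K)).mp this
  intro t
  obtain ⟨F, rfl⟩ := hθK t
  refine ⟨MvPowerSeries.C (MvPolynomial.eval z F), ?_⟩
  have hmem : F - MvPolynomial.C (MvPolynomial.eval z F) ∈ RingHom.ker θK := by
    rw [hz, MvPolynomial.mem_vanishingIdeal_singleton_iff]
    simp
  rw [RingHom.mem_ker, map_sub, sub_eq_zero] at hmem
  rw [hmem, hθK_C]
  rfl

end Presentation

end Summit.ResolutionOfSingularities.ResolutionOfSingularities.Theorems.TeissierResolve.BranchFiniteLemmas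

end
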